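import Summits.BirchSwinnertonDyer.Rank1Residual.Additive.GordEvenCongruentTorsionIsoMinimal
import Literature.NumberTheory.EllipticCurves.QuadraticTwistKroneckerLFunctionProofs
import Literature.NumberTheory.GaloisRepresentations.PadicAlgebraDegreeOnePlace
import Summits.BirchSwinnertonDyer.Rank1Residual.Additive.GordEvenCongruentPartnerBSD
import Summits.BirchSwinnertonDyer.Rank1Residual.X4.R1CertTemplate
import Summits.BirchSwinnertonDyer.Rank1Residual.Additive.JValuationOfIntModel
import Summits.BirchSwinnertonDyer.Rank1Residual.Additive.X4ThreeResCertKernel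
import Summits.BirchSwinnertonDyer.Rank1Residual.Additive.CyclotomicGoodReduction
import Summits.BirchSwinnertonDyer.Rank1Residual.Additive.MinimalGoodOrdinaryField
import Summits.BirchSwinnertonDyer.Rank1Residual.AdditivePotMult.TwistSupplyJClass
import Summits.BirchSwinnertonDyer.Rank1Residual.Additive.IntModelTamagawaCertificate
import Summits.BirchSwinnertonDyer.BirchSwinnertonDyer.Theorems.Rank1ResidualIntModelReduction
import Literature.NumberTheory.EllipticCurves.PointCountEulerCriterion
import Literature.NumberTheory.EllipticCurves.ComplexMultiplicationLocalFactorsAux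
import Summits.BirchSwinnertonDyer.Rank1Residual.Additive.GordEvenCongruentClassColumnsA
import Summits.BirchSwinnertonDyer.Rank1Residual.Additive.GordEvenCongruentClassColumnsB
import Summits.BirchSwinnertonDyer.Rank1Residual.Additive.GordEvenCongruentClassColumnsC
import Summits.BirchSwinnertonDyer.Rank1Residual.Additive.GordEvenCongruentClassColumnsD
import Summits.BirchSwinnertonDyer.Rank1Residual.Additive.GordEvenCongruentClassColumnsE
import Summits.BirchSwinnertonDyer.Rank1Residual.Additive.GordEvenCongruentClassColumnsF
import Summits.BirchSwinnertonDyer.Rank1Residual.Additive.GordEvenCongruentTorsionIsoRecords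
import Summits.BirchSwinnertonDyer.Rank1Residual.Additive.GordEvenCongruentPartnerBSDControl
import Summits.BirchSwinnertonDyer.Rank1Residual.Additive.LocalTowerKernelAtPTwistedOrdinaryClasses
import HarnessLib

/-!
# CLASS-COLUMNS-21, rows (part 2): the §C CONTROL row 499800el1 ↔ 9800bn1 @ 5 with the partner's
# place set `S₁ = {2, 5, 7}`, additivity at `2, 7`, goodness elsewhere and the level-`0` kernel at `5`
# (row T-T3B, p12's F6) all decided in the kernel — `bsdp_499800el1_five_control` / `_control'`
# (cell `b2b-bsdres`, team n1011, seat p07 (gen 9); r2 ROUTE-2 §II.32 ST-32.1; text = r2 GEN 26's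
# kernel-checked scratch `cells/n1011/route2/g26/ClassColumns21_g26.lean` c4287b3009a0cea1, §C section,
# token for token)

HONEST FRAMING (cell `b2b-bsdres`, run/shared/lean/b2b/bsd-rank1-residual/, verbatim in every
file): the goal of the cell is to DELETE the COMBINATION-SHAPED residual classes of the
Birch–Swinnerton-Dyer formula for ALL analytic-rank `≤ 1` elliptic curves over `ℚ` — "full BSD
formula for every rank `≤ 1` curve in class `C`" assembled STRICTLY from published theorems — so
that the rank-`≤ 1` remainder becomes exactly the CONSTRUCTION-SHAPED classes, which are TYPED
(missing-input `Prop`s), NOT attempted. This is not "finishing BSD". Team n1011 (N10/N11, the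
X4♯(G-ord) e346 receivers at `p = 5`): research route; labels and marks UNCHANGED; nothing booked;
census / instrument / planner output = EVIDENCE, never a Literature fact.
Theorems plus TWO bookkeeping definitions (`pl q hq` = the place of `ℚ` above the prime `q`;
`S9800bn1 = {pl 2, pl 5, pl 7}`); NO named fact; closes nothing; census −0.

## What

`bsdp_499800el1_five_control` = §C (`GordEvenCongruentPartnerBSDControl`, p304380) at
`W := C499800el1`, `W₁ := C9800bn1` with `hadd₁` (`2, 7` additive for 9800bn1: `Δ = −2⁸·5⁹·7⁹`,
`c₄` divisible), `hgood₁` (good off `{2, 5, 7}`) DECIDED, `hp0₁` reduced to the single place above `5`;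
`bsdp_499800el1_five_control'` discharges that too by p12's T-T3B F6
`GoodModelLine.ClassX4Gord.localTowerKerPrimary_zero_eq_bot_of_five_le_of_semistabilityIndex_ne_two`
(p305360): the partner then contributes ONLY its census column `hSel₁ : #Sel_{5^∞}(9800bn1/ℚ) = 1`.
Closes nothing; nothing booked.

References: as in `GordEvenCongruentPartnerBSDControl`; cells/n1011/ROUTE-2.md §II.32.
-/

set_option autoImplicit false

noncomputable section

open scoped Classical MatrixGroups ModularForm NumberField

open CongruenceSubgroup WeierstrassCurve NumberField IsDedekindDomain Field
  Literature.NumberTheory.EllipticCurves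
  Literature.NumberTheory.EllipticCurves.ModularForms
  Literature.NumberTheory.EllipticCurves.Rank1Residual
  Literature.NumberTheory.EllipticCurves.Rank1Residual.Typed
  Literature.NumberTheory.EllipticCurves.Delbourgo2002
  Literature.NumberTheory.EllipticCurves.Greenberg1999
  Literature.NumberTheory.EllipticCurves.GreenbergVatsal2000
  Literature.NumberTheory.EllipticCurves.CoatesGreenberg1996
  Literature.NumberTheory.EllipticCurves.Fisher2012
  Literature.NumberTheory.EllipticCurves.Rank1Residual.X11RankOneCertificates
  Summit.BirchSwinnertonDyer.BirchSwinnertonDyer.Rank1Residual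
  Summit.BirchSwinnertonDyer.BirchSwinnertonDyer.Rank2Observatory.Tam
  Summit.BirchSwinnertonDyer.Rank1Residual.X1.CongruenceTransfer
  Summit.BirchSwinnertonDyer.Rank1Residual.X4.R1CertTemplate
  Summit.BirchSwinnertonDyer.Rank1Residual.Additive
  Summit.BirchSwinnertonDyer.Rank1Residual.Additive.E346Links
  Summit.BirchSwinnertonDyer.Rank1Residual.Additive.IntModelTam
  Summit.BirchSwinnertonDyer.Rank1Residual.AdditivePotMult

namespace Summit.BirchSwinnertonDyer.Rank1Residual.Additive.E346Links

/-! ## §C row of record 499800el1 ↔ 9800bn1 @ 5 (p07 `GordEvenCongruentPartnerBSDControl`, CONTROL partner):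
the place bookkeeping `S₁ / hadd₁ / hgood₁` of 9800bn1 (`N = 9800 = 2³·5²·7²`, `|Δ| = 2⁸·5⁹·7⁹`) in the kernel -/

open Rat.HeightOneSpectrum

/-- The finite place of `ℚ` above the rational prime `q` — file-local bookkeeping for the place set
of the §C partner (the `(primesEquiv (R := 𝓞 ℚ)).symm ⟨q, hq⟩` idiom of `Rank1Residual/*`; r2's scratch
`route2/g26/ClassColumns21_g26.lean`, token for token). [folklore] -/
def pl (q : ℕ) (hq : q.Prime) : HeightOneSpectrum (𝓞 ℚ) := (primesEquiv (R := 𝓞 ℚ)).symm ⟨q, hq⟩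

/-- The prime under `pl q hq` is `q`. [folklore] -/
theorem primesEquiv_pl (q : ℕ) (hq : q.Prime) : (primesEquiv (pl q hq) : ℕ) = q :=
  congrArg Subtype.val ((primesEquiv (R := 𝓞 ℚ)).apply_symm_apply _)

/-- The bad places `{2, 5, 7}` of `9800bn1`. [folklore] -/
def S9800bn1 : Finset (HeightOneSpectrum (𝓞 ℚ)) :=
  {pl 2 Nat.prime_two, pl 5 (by norm_num), pl 7 (by norm_num)}

/-- A finite place of `ℚ` is `pl q hq` iff its prime is `q`. [folklore] -/
theorem eq_pl_iff (v : HeightOneSpectrum (𝓞 ℚ)) (q : ℕ) (hq : q.Prime) :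
    v = pl q hq ↔ (primesEquiv v : ℕ) = q := by
  constructor
  · rintro rfl; exact primesEquiv_pl q hq
  · intro h
    exact (primesEquiv (R := 𝓞 ℚ)).injective (Subtype.ext (h.trans (primesEquiv_pl q hq).symm))

/-- Membership in `S9800bn1` = the prime is `2`, `5` or `7`. [folklore] -/
theorem mem_S9800bn1_iff (v : HeightOneSpectrum (𝓞 ℚ)) :
    v ∈ S9800bn1 ↔ (primesEquiv v : ℕ) = 2 ∨ (primesEquiv v : ℕ) = 5 ∨ (primesEquiv v : ℕ) = 7 := by
  simp only [S9800bn1, Finset.mem_insert, Finset.mem_singleton, eq_pl_iff]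

/-- `Δ_min(9800bn1) = −2⁸·5⁹·7⁹`. Kernel-decided. [folklore] -/
theorem disc_9800bn1 : (⟨0, (-1), 0, 8167, (-6830963)⟩ : WeierstrassCurve ℤ).Δ = -(2 ^ 8 * 5 ^ 9 * 7 ^ 9) := by
  decide +kernel

/-- A prime dividing `Δ_min(9800bn1)` is `2`, `5` or `7`. [folklore] -/
theorem prime_dvd_disc_9800bn1 {q : ℕ} (hq : q.Prime)
    (h : (q : ℤ) ∣ (⟨0, (-1), 0, 8167, (-6830963)⟩ : WeierstrassCurve ℤ).Δ) : q = 2 ∨ q = 5 ∨ q = 7 := by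
  rw [disc_9800bn1, dvd_neg] at h
  have h' : q ∣ 2 ^ 8 * 5 ^ 9 * 7 ^ 9 := by exact_mod_cast h
  rcases (Nat.Prime.dvd_mul hq).mp h' with h₁ | h₇
  · rcases (Nat.Prime.dvd_mul hq).mp h₁ with h₂ | h₅
    · exact Or.inl ((Nat.prime_dvd_prime_iff_eq hq Nat.prime_two).mp (hq.dvd_of_dvd_pow h₂))
    · exact Or.inr (Or.inl ((Nat.prime_dvd_prime_iff_eq hq (by norm_num)).mp (hq.dvd_of_dvd_pow h₅)))
  · exact Or.inr (Or.inr ((Nat.prime_dvd_prime_iff_eq hq (by norm_num)).mp (hq.dvd_of_dvd_pow h₇)))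

/-- **`hadd₁` column: 9800bn1 is ADDITIVE at each of its bad places `2, 5, 7`** (`q ∣ Δ_min`, `q ∣ c₄ = −2⁶·5³·7²`;
Silverman VII.5.1(c), tree theorem `hasAdditiveReductionAt_of_dvd_of_dvd`). [folklore] -/
theorem hadd_9800bn1 : ∀ v ∈ S9800bn1, ((5 : ℕ) : 𝓞 ℚ) ∉ v.asIdeal → C9800bn1.HasAdditiveReductionAt v := by
  intro v hv _
  have hΔ : minimalDiscriminantInt C9800bn1 = (⟨0, (-1), 0, 8167, (-6830963)⟩ : WeierstrassCurve ℤ).Δ :=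
    IntModel.minimalDiscriminantInt_eq hI_9800bn1
  refine hasAdditiveReductionAt_of_dvd_of_dvd C9800bn1 v ?_ ?_ <;> rw [mem_S9800bn1_iff] at hv
  · rw [hΔ]; rcases hv with h | h | h <;> rw [h] <;> decide +kernel
  · rw [hI_9800bn1]; rcases hv with h | h | h <;> rw [h] <;> decide +kernel

/-- **`hgood₁` column: away from `{2, 5, 7}` the curve 9800bn1 has GOOD reduction and the place is prime to `5`.**
[folklore] -/
theorem hgood_9800bn1 : ∀ v ∉ S9800bn1, ((5 : ℕ) : 𝓞 ℚ) ∉ v.asIdeal ∧ C9800bn1.HasGoodReductionAt v := by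
  intro v hv
  rw [mem_S9800bn1_iff] at hv
  haveI : Fact (primesEquiv v : ℕ).Prime := ⟨(primesEquiv v).2⟩
  refine ⟨fun h5 => hv (Or.inr (Or.inl
    (Literature.NumberTheory.GaloisRepresentations.LocalField.primesEquiv_eq_of_natCast_mem 5 v h5))), ?_⟩
  rw [hasGoodReductionAt_iff_of_isMinimalAt (IsGloballyMinimal.isMinimal (W := C9800bn1) v),
    IntModel.Δ_eq_cast hI_9800bn1, (valuation_equiv_padicValuation v).eq_one_iff_eq_one,
    Rat.padicValuation_cast, Int.padicValuation_eq_one_iff]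
  exact fun h => hv (prime_dvd_disc_9800bn1 (primesEquiv v).2 h)

/-- **`hp0₁` reduced to the ONE place `v₅`**: the level-`0` local tower kernel input of §C quantifies over
`v ∈ S₁` with `5 ∈ v`, i.e. over `v = v₅` only. [folklore] -/
theorem hp0_9800bn1_of_at_five
    (hp0 : ∀ κ : ZpExtension ℚ 5, C9800bn1.localTowerKerPrimary κ ((pl 5 (by norm_num)).adicCompletion ℚ) 0 = ⊥) :
    ∀ (κ : ZpExtension ℚ 5), ∀ v ∈ S9800bn1, ((5 : ℕ) : 𝓞 ℚ) ∈ v.asIdeal →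
      C9800bn1.localTowerKerPrimary κ (v.adicCompletion ℚ) 0 = ⊥ := by
  intro κ v _ h5
  have hv : (primesEquiv v : ℕ) = 5 :=
    Literature.NumberTheory.GaloisRepresentations.LocalField.primesEquiv_eq_of_natCast_mem 5 v h5
  obtain rfl : v = pl 5 (by norm_num) := (eq_pl_iff v 5 (by norm_num)).mpr hv
  exact hp0 κ

/-- **`BSD(499800el1, 5)` = §C (p07 `ClassX4Gord.bsdp_rankZero_five_four_of_controlPartner_of_shaAn_unit`) at
`W := C499800el1`, `W₁ := C9800bn1`** — the CONTROL-partner road (Greenberg LNM 1716 Prop. 3.8 at `n = 0` via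
p06's F2b, consumed inside §C): the class columns `hX hcm he hX₁ hcm₁ he₁`, the I1 link modulo `hF`, AND the
partner's place bookkeeping `S₁ := {v₂, v₅, v₇}`, `hadd₁`, `hgood₁` are DISCHARGED in the kernel; `hp0₁` is
reduced to the single place `v₅` (= the output of row T-T3B: p12 F5 END ∘ p07 F4 ∘ F6, not yet composed for
this row). Remaining binders: PRINTED {`hC hDelA hDelM hDel hGZK hmod hCG hF`} · TYPED {`hGV`} · receiver
{`hr`} · partner census {`hSel₁` : `#Sel_{5^∞}(9800bn1) = 1`} · T-T3B output {`hp0₁` at `v₅`} · census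
EVIDENCE {`h hf hχ`} · period {`hq hu`} · `#Ш_an` {`hs hv`}. NO Delbourgo on the partner side, no `hna₁`.
Scratch; closes nothing; nothing booked. -/
theorem bsdp_499800el1_five_control
    (hC : Delbourgo2002.thmC_charIdeal_dvd_tameBranch)
    (hDelA : Delbourgo2002.mainTheorem) (hDelM : Delbourgo2002.mainTheorem_potMult)
    (hDel : Delbourgo1998.prop4_rankZero_pow_dvd_constantCoeff)
    (hGZK : rank_eq_analyticRank_of_analyticRank_le_one) (hmod : hasEntireLFunction_rat)
    (hGV : muLambdaAlg_transfer_of_torsionIso_potOrd_of_not_dvd_torsionOrder)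
    (hCG : H1_goodModelKernel_trivial.{0})
    (hF : thm132_fiveCongruent_hessePencil)
    (hr : C499800el1.analyticRank = 0)
    (hSel₁ : Nat.card (C9800bn1.selmerGroupPInfty 5) = 1)
    (hp0₁ : ∀ κ : ZpExtension ℚ 5,
      C9800bn1.localTowerKerPrimary κ ((pl 5 (by norm_num)).adicCompletion ℚ) 0 = ⊥)
    (h : CensusX43.OrdinaryTwistPartnerAt C499800el1 5)
    {N : ℕ} [NeZero N] {f : CuspForm (Gamma0 N) 2} (hf : IsNewformOf C499800el1 f)
    {χ : MulChar (ZMod 5) ℚ_[5]}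
    (hχ : CensusX43.IsTeichmullerPow χ (CensusX43.ordinaryTeichmullerExponent C499800el1 5))
    {q : ℚ} (hq : C499800el1.entireLFunction 1 = (q : ℂ) * (C499800el1.realPeriodRat : ℂ))
    {u : ℤ_[5]ˣ} (hu : ((ratPlusSymbol f 0 : ℚ) : ℚ_[5]) = ((u : ℤ_[5]) : ℚ_[5]) * (q : ℚ_[5]))
    {s : ℚ} (hs : shaAn C499800el1 = (s : ℂ)) (hv : padicValRat 5 s = 0) : BSDp C499800el1 5 :=
  classX4Gord_499800el1.bsdp_rankZero_five_four_of_controlPartner_of_shaAn_unit rfl hC hDelA hDelM hDel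
    hGZK hmod hGV hCG not_hasCM_499800el1 hr e_499800el1 classX4Gord_9800bn1 not_hasCM_9800bn1 e_9800bn1
    (torsionIso_9800bn1_499800el1 hF) hSel₁ S9800bn1 hadd_9800bn1 (hp0_9800bn1_of_at_five hp0₁)
    hgood_9800bn1 h hf hχ hq hu hs hv

/-- `hp0₁` DISCHARGED (T-T3B F6 class export p305360, p12): on 9800bn1 @ 5 (`ClassX4Gord`, `e = 4 ≠ 2`)
the `v ∣ 5` local tower kernel at level `0` vanishes for EVERY `ℤ_5`-extension. [folklore] -/
theorem hp0_9800bn1 : ∀ κ : ZpExtension ℚ 5, ∀ v ∈ S9800bn1, ((5 : ℕ) : 𝓞 ℚ) ∈ v.asIdeal →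
    C9800bn1.localTowerKerPrimary κ (v.adicCompletion ℚ) 0 = ⊥ :=
  fun κ _ _ hv =>
    GoodModelLine.ClassX4Gord.localTowerKerPrimary_zero_eq_bot_of_five_le_of_semistabilityIndex_ne_two
      classX4Gord_9800bn1 le_rfl (by rw [e_9800bn1]; decide) hv κ

/-- **499800el1 @ 5 via the CONTROL partner 9800bn1 with the whole T3 side DISCHARGED** (§C p304380 ∘
T-T3B F6 p305360 ∘ T-T3CTL F2b p303787): the partner contributes ONLY its census column
`hSel₁ : #Sel_{5^∞}(9800bn1/ℚ) = 1`; no `hp0₁`, no `hμ₁`, no `hna₁`, no Delbourgo on the partner side.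
Remaining binders = PRINTED facts + `hGV` + receiver census `hr` + `hSel₁` + census tuple + Manin + `#Ш_an`.
Scratch; closes nothing; nothing booked. [folklore] -/
theorem bsdp_499800el1_five_control'
    (hC : Delbourgo2002.thmC_charIdeal_dvd_tameBranch)
    (hDelA : Delbourgo2002.mainTheorem) (hDelM : Delbourgo2002.mainTheorem_potMult)
    (hDel : Delbourgo1998.prop4_rankZero_pow_dvd_constantCoeff)
    (hGZK : rank_eq_analyticRank_of_analyticRank_le_one) (hmod : hasEntireLFunction_rat)
    (hGV : muLambdaAlg_transfer_of_torsionIso_potOrd_of_not_dvd_torsionOrder)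
    (hCG : H1_goodModelKernel_trivial.{0})
    (hF : thm132_fiveCongruent_hessePencil)
    (hr : C499800el1.analyticRank = 0)
    (hSel₁ : Nat.card (C9800bn1.selmerGroupPInfty 5) = 1)
    (h : CensusX43.OrdinaryTwistPartnerAt C499800el1 5)
    {N : ℕ} [NeZero N] {f : CuspForm (Gamma0 N) 2} (hf : IsNewformOf C499800el1 f)
    {χ : MulChar (ZMod 5) ℚ_[5]}
    (hχ : CensusX43.IsTeichmullerPow χ (CensusX43.ordinaryTeichmullerExponent C499800el1 5))
    {q : ℚ} (hq : C499800el1.entireLFunction 1 = (q : ℂ) * (C499800el1.realPeriodRat : ℂ))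
    {u : ℤ_[5]ˣ} (hu : ((ratPlusSymbol f 0 : ℚ) : ℚ_[5]) = ((u : ℤ_[5]) : ℚ_[5]) * (q : ℚ_[5]))
    {s : ℚ} (hs : shaAn C499800el1 = (s : ℂ)) (hv : padicValRat 5 s = 0) : BSDp C499800el1 5 :=
  classX4Gord_499800el1.bsdp_rankZero_five_four_of_controlPartner_of_shaAn_unit rfl hC hDelA hDelM hDel
    hGZK hmod hGV hCG not_hasCM_499800el1 hr e_499800el1 classX4Gord_9800bn1 not_hasCM_9800bn1 e_9800bn1
    (torsionIso_9800bn1_499800el1 hF) hSel₁ S9800bn1 hadd_9800bn1 hp0_9800bn1 hgood_9800bn1 h hf hχ hq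
    hu hs hv

end Summit.BirchSwinnertonDyer.Rank1Residual.Additive.E346Links
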